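import Summits.QuantumFields.BalabanUV.T4Continuum.Support.DirichletDecoupledRegions

/-!
# `BalabanUV.T4Continuum.Support.DirichletDecoupledFamilies` — NE2 (node U1a) formalisation swarm, SUPPLIER item «Δ1-DECOUPLE» under the
# owner's sub-row `T4-U1a.S-NE2-D1-DIRICHLET°` (wall `hinj`), module (3): FINITE FAMILIES — the two-level injected law of the `U = 1`
# scalar Dirichlet tower passes from PAIRWISE SEPARATED pieces to their union with the SAME majorant; every finite union of pairwise
# separated LOCALLY MONOTONE sets of unit blocks obeys the Δ1-BESOV law and its scalar tower converges at rate `(√L)⁻¹`; every finite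
# union of pairwise separated COORDINATE BOXES obeys road P2's box law and converges at the FULL rate `L⁻¹`
# (unit b2b-balaban-t4-ne2-formalise-leaf-08, gen 4, v1)

HONEST FRAMING.  Rung (B)+1 bookkeeping at MODEL level (U = 1 scalar layer `Δ′ = Δ + a′Π′` of [B9] (3.24), King's planting, road P2's
compressed carriers BY NAME), finite torus; induction on the family over module (2)'s two-piece law — EXACT algebra, NOT a new analytic
estimate; NE2 (U1a) is NOT proved by this file; Δ1 NOT closed; spine PROVED 0/9 unchanged; NOT infinite volume, NOT the mass gap, NOT
Clay.  HONEST DEPENDENCY (verbatim): «continuum YM on T⁴ ⇐ BetaPertH ∧ nine spine estimates (0/9 proved); BetaPertH ⇐ (D1) ∧ (D4) ∧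
CAP+tail; G-an2-4 gates asym, D1 and NE2/3/4.»

WHAT THIS FILE PROVES (0 sorry), for a family `T : ι → (Tor M → Prop)` of decidable block sets, a finset `s`, and ANY decidable spelling
`S` of the union (`S b ↔ ∃ i ∈ s, T i b`):
 * §1 `injected_le_of_empty` (an empty region's defect is `0`); **`injected_le_of_pairwise_separated`**: pairwise `Separated` pieces each
   obeying the two-level injected law with majorant `e ≥ 0` ⟹ the union obeys it with the SAME `e` (`Finset.induction_on` over
   `DirichletDecoupledRegions.injected_le_of_separated_iff`); **`…_locallyMonotone`** (`besovConst d a′ 6 48·√R/√N`, leaf-08 g3) and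
   **`…_box`** (`Cbox d R a′/N`, gan24-p2);
 * §2 the tower ENDs through the owner's adapter (t4-ne2-p1 g12): **`towerLimitRate_dirichletScalar_family_monotone`** (rate `(√L)⁻¹`)
   and **`towerLimitRate_dirichletScalar_family_box`** (FULL rate `L⁻¹`) — displayed binders `2 ≤ L`, `0 < d`, `0 < a′`, pairwise
   `Separated`, the class of each piece, the spelling `iff`; nothing else.
Since the face-connected components of any set of unit blocks are pairwise separated, the Δ1 scalar two-level law now holds for EVERY
block set all of whose face-connected components are locally monotone (resp. coordinate boxes) — the decomposition is supplied by the
user as `(T, s)`; the OPEN residue of the scalar layer is the face-connected non-monotone configurations and the full rate beyond boxes.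

ABSOLUTE RULE (cell, verbatim): «No internally-minted statement may enter as a cited fact. Every hypothesis is either kernel-proved in
this package or a verbatim quotation of a PUBLISHED theorem with page reference. The manuscript(s) under audit are NOT citable for
their own disputed steps — they are the thing under adjudication; programme-internal (2001/route/tribunal) claims are never citable.»
[folklore]; no `def … : Prop` fact; nothing printed is a hypothesis.  NOT CLAIMED: face-connected non-monotone unions; the VECTOR layer;
[B9] (3.23)–(3.27) as printed; NE2; NE3; «not in print; our proof».
-/

noncomputable section

open scoped BigOperators ComplexConjugate Matrix Matrix.Norms.L2Operator
open Finset Filter Topology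

namespace Summit.QuantumFields.BalabanUV.T4Continuum.DirichletDecoupledFamilies

open Literature.MathematicalPhysics.QuantumFieldTheory.Balaban1983to89.B5Prop11Plancherel (Tor fine unitVec)
open Literature.MathematicalPhysics.QuantumFieldTheory.Balaban1983to89.B5G183RateUnitTower (lev lev_neZero)
open Summit.QuantumFields.BalabanUV.T4Continuum
open Summit.QuantumFields.BalabanUV.T4Continuum.CovariantAveragingTower (TowerLimitRate)
open Summit.QuantumFields.BalabanUV.T4Continuum.BalabanAveragedTowerUnit (one_le_lev')
open Summit.QuantumFields.BalabanUV.T4Continuum.BackgroundResolventTower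
open Summit.QuantumFields.BalabanUV.T4Continuum.ScalarAveragedPropagator (gammaPs)
open Summit.QuantumFields.BalabanUV.T4Continuum.DirichletScalarTower (DsR QsR JsR)
open Summit.QuantumFields.BalabanUV.T4Continuum.DirichletScalarTowerLevels (towerLimitRate_dirichletScalar_of_sqrt_levels
  towerLimitRate_dirichletScalar_of_inv_levels)
open Summit.QuantumFields.BalabanUV.T4Continuum.DirichletScalarTowerMonotone (two_le_mul_lev)
open Summit.QuantumFields.BalabanUV.T4Continuum.DirichletBesovTwoLevel (besovConst besovConst_nonneg)
open Summit.QuantumFields.BalabanUV.T4Continuum.DirichletMonotoneCutoff (LocallyMonotone)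
open Summit.QuantumFields.BalabanUV.T4Continuum.DirichletMonotoneTwoLevel (injected_le_of_locallyMonotone)
open Summit.QuantumFields.BalabanUV.T4Continuum.DirichletDecoupledRegions (Separated injected_le_of_separated_iff)
open Summit.QuantumFields.BalabanUV.Beta.GAN24.DirichletBoxTrace (blockReg)
open Summit.QuantumFields.BalabanUV.Beta.GAN24.DirichletBoxCompression (DOm JOm refineR)
open Summit.QuantumFields.BalabanUV.Beta.GAN24.DirichletBoxTwoLevel (IsCoordBox Cbox injected_le_box)
open Summit.QuantumFields.BalabanUV.T4Continuum.DirichletScalarTowerBox (Cbox_nonneg)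

variable {d : ℕ} {ι : Type*}

/-! ## §1 Pairwise separated finite families of block sets -/

section Family

variable (N R : ℕ) [NeZero N] [NeZero R] (M : Fin d → ℕ) [hM : ∀ μ, NeZero (M μ)] (a' : ℝ)
variable (T : ι → Tor M → Prop) [hT : ∀ i, DecidablePred (T i)]

/-- the two-level injected defect over an EMPTY region vanishes (empty index types), so it obeys every nonnegative bound. [folklore] -/
theorem injected_le_of_empty (S : Tor M → Prop) [DecidablePred S] (hS : ∀ b, ¬ S b) {e : ℝ} (he : 0 ≤ e) :
    ‖(DOm (R * N) M a' (refineR N R M (blockReg N M S)))⁻¹ * JOm N R M (blockReg N M S)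
        - JOm N R M (blockReg N M S) * (DOm N M a' (blockReg N M S))⁻¹‖ ≤ e := by
  haveI : IsEmpty {y // blockReg N M S y} := ⟨fun y => hS _ y.2⟩
  rw [Subsingleton.elim ((DOm (R * N) M a' (refineR N R M (blockReg N M S)))⁻¹ * JOm N R M (blockReg N M S)
    - JOm N R M (blockReg N M S) * (DOm N M a' (blockReg N M S))⁻¹) 0, norm_zero]
  exact he

/-- **THE DECOUPLING LAW FOR A FINITE FAMILY OF PAIRWISE SEPARATED SETS OF UNIT BLOCKS**: if the two-level injected law holds with
majorant `e ≥ 0` for every piece `T i`, `i ∈ s`, and the pieces are pairwise SEPARATED, it holds with the SAME `e` for their union `S`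
(`S b ↔ ∃ i ∈ s, T i b`; any decidable spelling). [folklore] -/
theorem injected_le_of_pairwise_separated (ha' : 0 < a') {e : ℝ} (he : 0 ≤ e) (s : Finset ι)
    (hsep : ∀ i ∈ s, ∀ j ∈ s, i ≠ j → Separated M (T i) (T j))
    (h : ∀ i ∈ s, ‖(DOm (R * N) M a' (refineR N R M (blockReg N M (T i))))⁻¹ * JOm N R M (blockReg N M (T i))
        - JOm N R M (blockReg N M (T i)) * (DOm N M a' (blockReg N M (T i)))⁻¹‖ ≤ e)
    (S : Tor M → Prop) [DecidablePred S] (hS : ∀ b, S b ↔ ∃ i ∈ s, T i b) :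
    ‖(DOm (R * N) M a' (refineR N R M (blockReg N M S)))⁻¹ * JOm N R M (blockReg N M S)
        - JOm N R M (blockReg N M S) * (DOm N M a' (blockReg N M S))⁻¹‖ ≤ e := by
  classical
  induction s using Finset.induction_on generalizing S with
  | empty => exact injected_le_of_empty N R M a' S (fun b hb => by obtain ⟨i, hi, _⟩ := (hS b).mp hb; exact Finset.notMem_empty i hi) he
  | insert i s hi IH =>
    have hsep' : ∀ i' ∈ s, ∀ j ∈ s, i' ≠ j → Separated M (T i') (T j) :=
      fun i' hi' j hj hne => hsep i' (Finset.mem_insert_of_mem hi') j (Finset.mem_insert_of_mem hj) hne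
    have h' : ∀ i' ∈ s, ‖(DOm (R * N) M a' (refineR N R M (blockReg N M (T i'))))⁻¹ * JOm N R M (blockReg N M (T i'))
        - JOm N R M (blockReg N M (T i')) * (DOm N M a' (blockReg N M (T i')))⁻¹‖ ≤ e := fun i' hi' => h i' (Finset.mem_insert_of_mem hi')
    have hrest := IH hsep' h' (fun b => ∃ j ∈ s, T j b) (fun _ => Iff.rfl)
    have hsepU : Separated M (T i) (fun b => ∃ j ∈ s, T j b) := by
      intro b₁ b₂ h₁ h₂
      obtain ⟨j, hj, h₂⟩ := h₂
      exact hsep i (Finset.mem_insert_self i s) j (Finset.mem_insert_of_mem hj) (fun e => hi (e ▸ hj)) b₁ b₂ h₁ h₂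
    refine injected_le_of_separated_iff N R M a' S (fun b => ?_) hsepU ha' (h i (Finset.mem_insert_self i s)) hrest
    rw [hS b]
    simp only [Finset.mem_insert, or_and_right, exists_or, exists_eq_left]

/-- **PAIRWISE SEPARATED LOCALLY MONOTONE PIECES**: the union obeys the Δ1-BESOV law `besovConst d a′ 6 48·√R/√N`. [folklore] -/
theorem injected_le_of_pairwise_separated_locallyMonotone (hN : 1 ≤ N) (hRN : 2 ≤ R * N) (ha' : 0 < a') (s : Finset ι)
    (hsep : ∀ i ∈ s, ∀ j ∈ s, i ≠ j → Separated M (T i) (T j)) (hmono : ∀ i ∈ s, LocallyMonotone M (T i))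
    (S : Tor M → Prop) [DecidablePred S] (hS : ∀ b, S b ↔ ∃ i ∈ s, T i b) :
    ‖(DOm (R * N) M a' (refineR N R M (blockReg N M S)))⁻¹ * JOm N R M (blockReg N M S)
        - JOm N R M (blockReg N M S) * (DOm N M a' (blockReg N M S))⁻¹‖ ≤ besovConst d a' 6 48 * Real.sqrt R / Real.sqrt N :=
  injected_le_of_pairwise_separated N R M a' T ha' (div_nonneg (mul_nonneg (besovConst_nonneg d a' 6 48) (Real.sqrt_nonneg _))
    (Real.sqrt_nonneg _)) s hsep (fun i hi => injected_le_of_locallyMonotone N R M (T i) (hmono i hi) hN hRN ha') S hS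

/-- **PAIRWISE SEPARATED COORDINATE BOXES**: the union obeys road P2's box law `Cbox d R a′/N` (FULL rate). [folklore] -/
theorem injected_le_of_pairwise_separated_box (hN : 1 ≤ N) (ha' : 0 < a') (s : Finset ι)
    (hsep : ∀ i ∈ s, ∀ j ∈ s, i ≠ j → Separated M (T i) (T j)) (hbox : ∀ i ∈ s, IsCoordBox M (T i))
    (S : Tor M → Prop) [DecidablePred S] (hS : ∀ b, S b ↔ ∃ i ∈ s, T i b) :
    ‖(DOm (R * N) M a' (refineR N R M (blockReg N M S)))⁻¹ * JOm N R M (blockReg N M S)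
        - JOm N R M (blockReg N M S) * (DOm N M a' (blockReg N M S))⁻¹‖ ≤ Cbox d R a' / N :=
  injected_le_of_pairwise_separated N R M a' T ha' (div_nonneg (Cbox_nonneg (d := d) a' R) (Nat.cast_nonneg N)) s hsep
    (fun i hi => injected_le_box N R M (T i) (hbox i hi) hN ha') S hS

end Family

/-! ## §2 The tower ENDs for finite families -/

section Tower

variable (L : ℕ) [NeZero L] (M : Fin d → ℕ) [hM : ∀ μ, NeZero (M μ)] (a' : ℝ) (T : ι → Tor M → Prop) [hT : ∀ i, DecidablePred (T i)]

/-- **THE Ω-RESTRICTED UNIT-LATTICE SCALAR FREE COVARIANCES OF ANY FINITE UNION OF PAIRWISE SEPARATED LOCALLY MONOTONE REGIONS CONVERGE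
AT THE RATE `(√L)⁻¹`** (`L ≥ 2`, `d ≥ 1`, `a′ > 0`), UNCONDITIONALLY. [folklore] -/
theorem towerLimitRate_dirichletScalar_family_monotone (hL : 2 ≤ L) (hd : 0 < d) (ha' : 0 < a') (s : Finset ι)
    (hsep : ∀ i ∈ s, ∀ j ∈ s, i ≠ j → Separated M (T i) (T j)) (hmono : ∀ i ∈ s, LocallyMonotone M (T i))
    (S : Tor M → Prop) [DecidablePred S] (hS : ∀ b, S b ↔ ∃ i ∈ s, T i b) :
    TowerLimitRate (QsR L M (blockReg (lev L 0) M S)) ((L : ℝ) ^ d) (fun k => (DsR L M a' (blockReg (lev L 0) M S) k)⁻¹)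
      (Cpert 0 (2 * d * Real.sqrt ((gammaPs d a')⁻¹)) (besovConst d a' 6 48 * Real.sqrt (L : ℝ)) 0 0 0) ((Real.sqrt (L : ℝ))⁻¹) :=
  towerLimitRate_dirichletScalar_of_sqrt_levels L M a' S hL hd ha' fun k =>
    injected_le_of_pairwise_separated_locallyMonotone (lev L k) L M a' T (one_le_lev' L k) (two_le_mul_lev L hL k) ha' s hsep hmono S hS

/-- **… AND OF ANY FINITE UNION OF PAIRWISE SEPARATED COORDINATE BOXES AT THE FULL RATE `L⁻¹`**. [folklore] -/
theorem towerLimitRate_dirichletScalar_family_box (hL : 2 ≤ L) (hd : 0 < d) (ha' : 0 < a') (s : Finset ι)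
    (hsep : ∀ i ∈ s, ∀ j ∈ s, i ≠ j → Separated M (T i) (T j)) (hbox : ∀ i ∈ s, IsCoordBox M (T i))
    (S : Tor M → Prop) [DecidablePred S] (hS : ∀ b, S b ↔ ∃ i ∈ s, T i b) :
    TowerLimitRate (QsR L M (blockReg (lev L 0) M S)) ((L : ℝ) ^ d) (fun k => (DsR L M a' (blockReg (lev L 0) M S) k)⁻¹)
      (Cpert 0 (2 * d * Real.sqrt ((gammaPs d a')⁻¹)) (Cbox d L a') 0 0 0) ((L : ℝ)⁻¹) :=
  towerLimitRate_dirichletScalar_of_inv_levels L M a' S hL hd ha' fun k =>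
    injected_le_of_pairwise_separated_box (lev L k) L M a' T (one_le_lev' L k) ha' s hsep hbox S hS

end Tower

end Summit.QuantumFields.BalabanUV.T4Continuum.DirichletDecoupledFamilies

end
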